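import Mathlib
import HarnessLib
import Summits.QuantumFields.YangMills.Theses.PencilRigidity
import Summits.QuantumFields.YangMills.Theorems.PencilRigidityCurvatureKernelBoundReductionDFree
import Summits.QuantumFields.YangMills.Theorems.PencilRigidityCurvatureKernelBoundCruxToLocalDecay
import Summits.QuantumFields.YangMills.Theorems.PencilRigidityCurvatureKernelBoundKernelExistenceOfLocalDecay
import Summits.QuantumFields.YangMills.Theorems.PencilRigidityCurvatureKernelBoundAxialGrowthOfLocalDecay

/-!
# `CurvatureKernelBound` — the crux is EQUIVALENT to the two-point local decay T (support for stmt-QuantumFields-11687)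

Crux `stmt-QuantumFields-11687` (`PencilRigidity.CurvatureKernelBound`), line `sixteen-charts-analytic-kernel`, skeleton v16
(continuation lead c5), registered sub-goal `CurvatureKernelBoundIffLocalDecay`. **Statement.** `CurvatureKernelBound ↔ T`, where
T (`TwoPointLocalDecay` of the skeleton) says: for every compact simple `G`, `r`, `sch` and one-species `S₁` carrying the curvature
package `W₁`, there are `C`, `η > 0`, `s₁ > 0` such that at every height `s ∈ (0, s₁)` the local two-point bounds near the time axis
hold — `‖S₁ 2 F‖ ≤ A ‖f₀‖₁ ‖f₁‖₁ + B r⁸ ‖f₀‖∞ ‖f₁‖∞` for real tensors `F = f₀ ⊗ f₁` supported in `r`-balls (`r ≤ r₀(s)`) about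
`−s e₀`, `+s e₀` — with constants `A + B ≤ C s^(η−10)`. This is the EXACT residue of the crux in continuum currency: D-free (no
diagonal-mirror reflection positivity), sign-free (no condition on `β_k`), lattice-free, kernel-free. **Proof.** `→` is the landed
N′ `CruxToLocalDecay` (a kernel with `|K| ≤ C(1 + ‖ξ‖^(η−10))` is `≤ C' s^(min η 10 − 10)` on the shell `s ≤ ‖ξ‖ ≤ 3s`); `←` is the
landed D-free reduction G `CurvatureKernelBoundReductionDFree` fed with I₁ `KernelExistenceOfLocalDecay` (T ⇒ a kernel continuous off
`0` representing `S₁ 2` on `⁰𝒮₂`, via X `KernelExistence`) and I₂ `AxialGrowthOfLocalDecay` (T ⇒ the axial growth bound of every such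
kernel, by bump localisation at `∓(s/2)e₀` and evenness). [folklore]
-/

noncomputable section

namespace Summit.QuantumFields.YangMills.Theorems.CurvatureKernel

/-- **`CurvatureKernelBoundIffLocalDecay`** (registered sub-goal of stmt-QuantumFields-11687, skeleton v16 of line
`sixteen-charts-analytic-kernel`): the crux `CurvatureKernelBound` is equivalent to the two-point local decay T — local
`L¹⊗L¹ + r⁸ L∞⊗L∞` bounds on `S₁ 2` about `∓s e₀` with constants `A + B ≤ C s^(η−10)`, for every `W₁`-datum. [folklore] -/
theorem CurvatureKernelBoundIffLocalDecay : open Literature.MathematicalPhysics.QuantumLattice Literature.MathematicalPhysics.AQFT Literature.MathematicalPhysics.QuantumFieldTheory in Summit.QuantumFields.YangMills.Theses.PencilRigidity.CurvatureKernelBound ↔ (∀ (G : Type) [Group G] [TopologicalSpace G] [IsTopologicalGroup G] [CompactSpace G] [MeasurableSpace G] [BorelSpace G], IsCompactSimpleLieGroup G → ∀ (r : LatticeRep G) (sch : SpeciesScheme (YMSpecies G)) (S₁ : SchwingerFamily (EuclideanSpace ℝ (Fin 4))), ((∀ (n : ℕ), n ≠ 0 → ∀ (f : Fin n → SchwartzMap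 (EuclideanSpace ℝ (Fin 4)) ℝ) (F : SchwartzMap (Fin n → (EuclideanSpace ℝ (Fin 4))) ℂ), IsTensorOf F (fun i => ofRealTest (f i)) → IsOffDiagonal F → Filter.Tendsto (fun k : ℕ => ((latticeSchwinger r.ρ sch (fun s => s.F) k n (fun _ => r.curvature) f : ℝ) : ℂ)) Filter.atTop (nhds (S₁ n F))) ∧ (S₁.toLabelled.IsNormalized ∧ S₁.toLabelled.IsHermitian ∧ S₁.toLabelled.HasLinearGrowth ∧ S₁.toLabelled.IsReflectionPositive ∧ S₁.toLabelled.IsSymmetric ∧ S₁.toLabelled.HasClusterProperty) ∧ (∀ (n : ℕ) (a : (EuclideanSpace ℝ (Fin 4))) (F : SchwartzMap (Fin n → (EuclideanSpace ℝ (Fin 4))) ℂ), IsOffDiagonal F → S₁ n (translateMulti a F) = S₁ n F) ∧ (∀ (R : (EuclideanSpace ℝ (Fin 4)) ≃ₗᵢ[ℝ] (EuclideanSpace ℝ (Fin 4))), LinearMap.det (R.toLinearEquiv : (EuclideanSpace ℝ (Fin 4)) →ₗ[ℝ] (EuclideanSpace ℝ (Fin 4))) = 1 → (∀ i : Fin 4,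 ∃ j : Fin 4, R (EuclideanSpace.single i 1) = EuclideanSpace.single j 1 ∨ R (EuclideanSpace.single i 1) = -EuclideanSpace.single j 1) → ∀ (n : ℕ) (F : SchwartzMap (Fin n → (EuclideanSpace ℝ (Fin 4))) ℂ), IsOffDiagonal F → S₁ n (linActMulti R F) = S₁ n F) ∧ (∃ Δ : ℝ, 0 < Δ ∧ S₁.toLabelled.HasMassGap Δ ∧ HasLatticeMassGap r sch Δ)) → ∃ (C η s₁ : ℝ), 0 < η ∧ 0 < s₁ ∧ (∀ (s : ℝ), 0 < s → s < s₁ → ∃ (r₀ A B : ℝ), 0 < r₀ ∧ 0 ≤ A ∧ 0 ≤ B ∧ A + B ≤ C * s ^ (η - 10) ∧ (∀ (r : ℝ), 0 < r → r ≤ r₀ → ∀ (f : Fin 2 → SchwartzMap (EuclideanSpace ℝ (Fin 4)) ℝ) (F : SchwartzMap (Fin 2 → (EuclideanSpace ℝ (Fin 4))) ℂ) (M₀ M₁ : ℝ), IsTensorOf F (fun i => ofRealTest (f i)) → tsupport ((f 0 : SchwartzMap (EuclideanSpace ℝ (Fin 4)) ℝ) : (EuclideanSpace ℝ (Fin 4))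 → ℝ) ⊆ Metric.closedBall (EuclideanSpace.single (0 : Fin 4) (-s)) r → tsupport ((f 1 : SchwartzMap (EuclideanSpace ℝ (Fin 4)) ℝ) : (EuclideanSpace ℝ (Fin 4)) → ℝ) ⊆ Metric.closedBall (EuclideanSpace.single (0 : Fin 4) s) r → (∀ x, |f 0 x| ≤ M₀) → (∀ x, |f 1 x| ≤ M₁) → ‖S₁ 2 F‖ ≤ A * (∫ x : (EuclideanSpace ℝ (Fin 4)), |f 0 x|) * (∫ x : (EuclideanSpace ℝ (Fin 4)), |f 1 x|) + B * r ^ 8 * M₀ * M₁))) :=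
  ⟨CruxToLocalDecay, fun hT => CurvatureKernelBoundReductionDFree (KernelExistenceOfLocalDecay hT) (AxialGrowthOfLocalDecay hT)⟩

end Summit.QuantumFields.YangMills.Theorems.CurvatureKernel

end
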